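import Mathlib
import HarnessLib
import Literature.Analysis.FluidPDE.AxisymOuterBounds

/-!
# Route `QuarterLogPincer`, crux `TypeIQuantSubcubicExp` (stmt-NavierStokesRegularity-24077), line `silencing_cost` —
# Sd `EmberReadout` (ELEMENTARY): enstrophy in a regular box forces cube mass

ns-idea-7's line `Cruxes/TypeIQuantSubcubicExp/Lines/silencing_cost.lean` (v1.1, 338118c44af2; idea-crit-4 g8 PASS
2026-08-29T06:01Z) carries the stub Sd `stub_emberReadout : EmberReadout` (:598, «size S–M; ELEMENTARY; certainly true»):
for `K ≥ 1`, `M₁ ≥ 1`, `c > 0` there is `c' = c'(K, M₁, c) > 0` such that a `C²` field with the scale-`σ` `C²` bound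
`‖Dʲv‖ ≤ M₁ σ^{-(j+1)}` (`j ≤ 2`) on `B(y, 2Kσ)` and enstrophy `∫_{B(y,Kσ)} |curl v|² ≥ c/σ` has cube
`∫_{B(y,2Kσ)} |v|³ ≥ c'`.  This file proves the statement with its binders VERBATIM as the theorem `emberReadout` (the
line's `def EmberReadout` is not yet an importable tree object; once it is, `stub_emberReadout := emberReadout` closes it
by unfolding).  Mechanism (the docstring's, made explicit): (1) a point `x⋆ ∈ B(y,Kσ)` with
`|curl v(x⋆)|² ≥ m/σ⁴`, `m := c/(2V₁K³)` (`V₁ = |B(0,1)|`; else the enstrophy integral is `≤ c/(2σ)`)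
(`exists_sq_le_norm_curl_of_lintegral`); (2) `‖Dv(x⋆)‖ ≥ g/σ²`, `g := √m/(κ+1)` (`|curl w| ≤ κ‖Dw‖`,
`κ = ‖curlCLM‖`), hence a coordinate direction `eᵢ` with `‖Dv(x⋆)eᵢ‖ ≥ g/(3σ²)` (`exists_norm_apply_single_ge`); (3)
second-order Taylor along `eᵢ` with step `θσ`, `θ := min (g/(6M₁)) (K/2)`: `|v(x⋆ + θσ eᵢ) − v(x⋆)| ≥ θg/(6σ)`
(`taylor_step_lower_bound`), so `|v| ≥ w/σ`, `w := θg/12`, at `x⋆` or at `x⋆ + θσ eᵢ`; (4)–(5) the gradient bound keeps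
`|v| ≥ w/(2σ)` on the ball of radius `ρσ`, `ρ := min (w/(2M₁)) (K/2)`, around that point, inside `B(y,2Kσ)`, whence
cube `≥ (w/2)³ ρ³ V₁ =: c'`, scale-free (`cube_lower_bound_of_point`).

HONEST FRAME: an elementary calculus inequality for `C²` vector fields; no Navier–Stokes object; nothing here bears on
24077's truth, W7 or Navier–Stokes regularity (OPEN / not proved).  pub-ns-dss typer (g38),
`--supports stmt-NavierStokesRegularity-24077`.
-/

noncomputable section

set_option linter.dupNamespace false

namespace Summit.NavierStokesRegularity.NavierStokesRegularity.Cruxes.TypeIQuantSubcubicExp.SilencingCost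

open MeasureTheory Set Function Filter Topology Metric
open scoped ENNReal NNReal
open Literature.Analysis Literature.Analysis.FluidPDE

/-! ### Small tools -/

/-- In `ℝ³`, `‖A‖ ≤ ∑ᵢ ‖A eᵢ‖` over the coordinate vectors. -/
theorem opNorm_le_sum_norm_apply_single
    (A : EuclideanSpace ℝ (Fin 3) →L[ℝ] EuclideanSpace ℝ (Fin 3)) :
    ‖A‖ ≤ ∑ i : Fin 3, ‖A (EuclideanSpace.single i (1 : ℝ))‖ := by
  refine ContinuousLinearMap.opNorm_le_bound _ (Finset.sum_nonneg fun _ _ => norm_nonneg _) fun x => ?_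
  have hx : x = ∑ i : Fin 3, x i • EuclideanSpace.single i (1 : ℝ) := by
    simpa using ((EuclideanSpace.basisFun (Fin 3) ℝ).sum_repr x).symm
  calc ‖A x‖ = ‖∑ i : Fin 3, x i • A (EuclideanSpace.single i (1 : ℝ))‖ := by
        conv_lhs => rw [hx]
        simp only [map_sum, map_smul]
    _ ≤ ∑ i : Fin 3, ‖x i • A (EuclideanSpace.single i (1 : ℝ))‖ := norm_sum_le _ _
    _ ≤ ∑ i : Fin 3, ‖A (EuclideanSpace.single i (1 : ℝ))‖ * ‖x‖ :=
        Finset.sum_le_sum fun i _ => by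
          rw [norm_smul, mul_comm]
          exact mul_le_mul_of_nonneg_left (by simpa using PiLp.norm_apply_le x i) (norm_nonneg _)
    _ = (∑ i : Fin 3, ‖A (EuclideanSpace.single i (1 : ℝ))‖) * ‖x‖ := by rw [Finset.sum_mul]

/-- A coordinate direction carrying a third of the operator norm: if `a ≤ ‖A‖` then `a/3 ≤ ‖A eᵢ‖` for some `i`. -/
theorem exists_norm_apply_single_ge (A : EuclideanSpace ℝ (Fin 3) →L[ℝ] EuclideanSpace ℝ (Fin 3)) {a : ℝ}
    (ha : a ≤ ‖A‖) : ∃ i : Fin 3, a / 3 ≤ ‖A (EuclideanSpace.single i (1 : ℝ))‖ := by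
  by_contra hcon
  push Not at hcon
  have hsum : ∑ i : Fin 3, ‖A (EuclideanSpace.single i (1 : ℝ))‖ < 3 * (a / 3) := by
    calc ∑ i : Fin 3, ‖A (EuclideanSpace.single i (1 : ℝ))‖
        < ∑ _i : Fin 3, a / 3 := Finset.sum_lt_sum_of_nonempty Finset.univ_nonempty fun i _ => hcon i
      _ = 3 * (a / 3) := by simp
  have h3 : 3 * (a / 3) = a := by ring
  linarith [opNorm_le_sum_norm_apply_single A]

/-- The first derivative as an order-one Taylor coefficient: `‖D¹v(x)‖ = ‖Dv(x)‖`. -/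
theorem norm_iteratedFDeriv_one_eq_norm_fderiv {v : EuclideanSpace ℝ (Fin 3) → EuclideanSpace ℝ (Fin 3)}
    (x : EuclideanSpace ℝ (Fin 3)) : ‖iteratedFDeriv ℝ 1 v x‖ = ‖fderiv ℝ v x‖ := by
  rw [← norm_iteratedFDeriv_fderiv, norm_iteratedFDeriv_zero]

/-- The second derivative as an order-two Taylor coefficient: `‖D(Dv)(x)‖ = ‖D²v(x)‖`. -/
theorem norm_fderiv_fderiv_eq_norm_iteratedFDeriv_two
    {v : EuclideanSpace ℝ (Fin 3) → EuclideanSpace ℝ (Fin 3)} (x : EuclideanSpace ℝ (Fin 3)) :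
    ‖fderiv ℝ (fderiv ℝ v) x‖ = ‖iteratedFDeriv ℝ 2 v x‖ := by
  rw [← norm_iteratedFDeriv_fderiv, ← norm_iteratedFDeriv_fderiv, norm_iteratedFDeriv_zero]

/-- Scale bookkeeping for the cube integral: `(w/(2σ))³ · ((ρσ)³ V) = (w/2)³ ρ³ V`. -/
theorem cube_scale_identity {w ρ σ V : ℝ} (hσ : 0 < σ) :
    (w / (2 * σ)) ^ 3 * ((ρ * σ) ^ 3 * V) = (w / 2) ^ 3 * ρ ^ 3 * V := by
  have hσ0 : σ ≠ 0 := hσ.ne'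
  field_simp
  try ring

/-- Scale bookkeeping for the gradient step: `(M/σ²) · ((w/(2M)) σ) = w/(2σ)`. -/
theorem grad_scale_identity {M w σ : ℝ} (hM : 0 < M) (hσ : 0 < σ) :
    M / σ ^ 2 * (w / (2 * M) * σ) = w / (2 * σ) := by
  have hσ0 : σ ≠ 0 := hσ.ne'
  have hM0 : M ≠ 0 := hM.ne'
  field_simp
  try ring

/-! ### Step 1: a point of the inner ball with large curl -/

/-- If `∫_{B(y,Kσ)} ‖curl v‖² ≥ c/σ` then some point of `B(y,Kσ)` has `‖curl v‖² ≥ m/σ⁴` with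
`m = c/(2V₁K³)`, `V₁ = |B(0,1)|` (otherwise the integral is at most `c/(2σ)`). -/
theorem exists_sq_le_norm_curl_of_lintegral {K c σ : ℝ} (hK : 0 < K) (hc : 0 < c) (hσ : 0 < σ)
    {v : EuclideanSpace ℝ (Fin 3) → EuclideanSpace ℝ (Fin 3)} {y : EuclideanSpace ℝ (Fin 3)}
    (henst : ENNReal.ofReal (c / σ) ≤ ∫⁻ x in ball y (K * σ), ‖curl v x‖ₑ ^ 2) :
    ∃ xs ∈ ball y (K * σ),
      c / (2 * (volume (ball (0 : EuclideanSpace ℝ (Fin 3)) 1)).toReal * K ^ 3) / σ ^ 4 ≤ ‖curl v xs‖ ^ 2 := by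
  set V₁ : ℝ := (volume (ball (0 : EuclideanSpace ℝ (Fin 3)) 1)).toReal with hV₁
  have hvol_top : volume (ball (0 : EuclideanSpace ℝ (Fin 3)) 1) ≠ ∞ := measure_ball_lt_top.ne
  have hvol_pos : 0 < volume (ball (0 : EuclideanSpace ℝ (Fin 3)) 1) := measure_ball_pos _ _ one_pos
  have hV₁pos : 0 < V₁ := ENNReal.toReal_pos hvol_pos.ne' hvol_top
  have hV₁E : ENNReal.ofReal V₁ = volume (ball (0 : EuclideanSpace ℝ (Fin 3)) 1) := ENNReal.ofReal_toReal hvol_top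
  clear_value V₁
  have hKσ : 0 < K * σ := mul_pos hK hσ
  set m : ℝ := c / (2 * V₁ * K ^ 3) with hm
  by_contra hcon
  push Not at hcon
  have hle : ∫⁻ x in ball y (K * σ), ‖curl v x‖ₑ ^ 2 ≤ ∫⁻ _ in ball y (K * σ), ENNReal.ofReal (m / σ ^ 4) := by
    refine setLIntegral_mono' measurableSet_ball fun x hx => ?_
    rw [← ofReal_norm, ← ENNReal.ofReal_pow (norm_nonneg _)]
    exact ENNReal.ofReal_le_ofReal (hcon x hx).le
  rw [setLIntegral_const, Measure.addHaar_ball_of_pos _ _ hKσ, finrank_euclideanSpace_fin,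
    ← hV₁E, ← ENNReal.ofReal_mul (by positivity), ← ENNReal.ofReal_mul (by positivity)] at hle
  have hval : m / σ ^ 4 * ((K * σ) ^ 3 * V₁) = c / (2 * σ) := by
    rw [hm]
    field_simp
    try ring
  rw [hval] at hle
  have hlt : ENNReal.ofReal (c / (2 * σ)) < ENNReal.ofReal (c / σ) := by
    rw [ENNReal.ofReal_lt_ofReal_iff (by positivity), div_lt_div_iff₀ (by positivity) hσ]
    nlinarith
  exact (lt_irrefl _) ((henst.trans hle).trans_lt hlt)

/-! ### Step 3: the second-order Taylor step -/

/-- **Taylor step.**  Let `v` be differentiable with `Dv` differentiable, `‖D(Dv)‖ ≤ M₁/σ³` on the ball `B(y, 2Kσ)`,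
`x⋆` with `‖x⋆ − y‖ < Kσ`, a unit vector `e` with `‖Dv(x⋆) e‖ ≥ g/(3σ²)`, and a step fraction `0 < θ ≤ g/(6M₁)`,
`θ ≤ K/2`.  Then `x⋆ + θσ e` stays within `3Kσ/2` of `y` and `‖v(x⋆ + θσ e) − v(x⋆)‖ ≥ θg/(6σ)`. -/
theorem taylor_step_lower_bound {K M₁ σ g θ : ℝ} (hK : 0 < K) (hM₁ : 0 < M₁) (hσ : 0 < σ) (hθ : 0 < θ)
    (hθg : θ ≤ g / (6 * M₁)) (hθK : θ ≤ K / 2)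
    {v : EuclideanSpace ℝ (Fin 3) → EuclideanSpace ℝ (Fin 3)} {y xs e : EuclideanSpace ℝ (Fin 3)}
    (hdiff : ∀ x, DifferentiableAt ℝ v x) (hdiff' : ∀ x, DifferentiableAt ℝ (fderiv ℝ v) x)
    (hb2 : ∀ x ∈ ball y (2 * K * σ), ‖fderiv ℝ (fderiv ℝ v) x‖ ≤ M₁ / σ ^ 3)
    (hxs : ‖xs - y‖ < K * σ) (he : ‖e‖ = 1) (hAe : g / (3 * σ ^ 2) ≤ ‖fderiv ℝ v xs e‖) :
    ‖xs + (θ * σ) • e - y‖ < 3 / 2 * K * σ ∧ θ * g / (6 * σ) ≤ ‖v (xs + (θ * σ) • e) - v xs‖ := by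
  have hK0 : 0 ≤ K := hK.le
  set A : EuclideanSpace ℝ (Fin 3) →L[ℝ] EuclideanSpace ℝ (Fin 3) := fderiv ℝ v xs with hA
  set h : ℝ := θ * σ with hh
  have hhpos : 0 < h := mul_pos hθ hσ
  have hhe : ‖h • e‖ = h := by rw [norm_smul, he, mul_one, Real.norm_of_nonneg hhpos.le]
  set xe : EuclideanSpace ℝ (Fin 3) := xs + h • e with hxe
  have hxs2 : xs ∈ ball y (2 * K * σ) := by
    rw [mem_ball_iff_norm]
    exact hxs.trans_le (mul_le_mul_of_nonneg_right (by nlinarith [hK0]) hσ.le)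
  have hxed : ‖xe - y‖ < 3 / 2 * K * σ := by
    have h1 : ‖xe - y‖ ≤ ‖h • e‖ + ‖xs - y‖ := by
      rw [hxe, show xs + h • e - y = h • e + (xs - y) by abel]
      exact norm_add_le _ _
    rw [hhe] at h1
    have h2 : h ≤ K / 2 * σ := by rw [hh]; exact mul_le_mul_of_nonneg_right hθK hσ.le
    calc ‖xe - y‖ ≤ h + ‖xs - y‖ := h1
      _ < K / 2 * σ + K * σ := add_lt_add_of_le_of_lt h2 hxs
      _ = 3 / 2 * K * σ := by ring
  have hxe2 : xe ∈ ball y (2 * K * σ) := by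
    rw [mem_ball_iff_norm]
    exact hxed.trans_le (mul_le_mul_of_nonneg_right (by nlinarith) hσ.le)
  refine ⟨hxed, ?_⟩
  have hseg : segment ℝ xs xe ⊆ ball y (2 * K * σ) := (convex_ball y _).segment_subset hxs2 hxe2
  -- `‖Dv(x) - A‖ ≤ (M₁/σ³) h` on the segment
  have hDA : ∀ x ∈ segment ℝ xs xe, ‖fderiv ℝ v x - A‖ ≤ M₁ / σ ^ 3 * h := by
    intro x hx
    have hmv := (convex_ball y (2 * K * σ)).norm_image_sub_le_of_norm_fderiv_le
      (f := fderiv ℝ v) (fun z _ => hdiff' z) hb2 hxs2 (hseg hx)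
    rw [hA]
    refine hmv.trans (mul_le_mul_of_nonneg_left ?_ (by positivity))
    obtain ⟨a, b, ha, hb, hab, rfl⟩ := hx
    have e1 : a • xs + b • xe - xs = b • (h • e) := by
      rw [hxe, smul_add, ← add_assoc, ← add_smul, hab, one_smul]; abel
    rw [e1, norm_smul, hhe, Real.norm_of_nonneg hb]
    nlinarith [hhpos]
  have hT := (convex_segment xs xe).norm_image_sub_le_of_norm_fderiv_le' (f := v) (φ := A)
    (fun z _ => hdiff z) hDA (left_mem_segment ℝ xs xe) (right_mem_segment ℝ xs xe)
  have exe : xe - xs = h • e := by rw [hxe]; abel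
  rw [exe, hhe, map_smul] at hT
  -- `‖v xe - v xs‖ ≥ h ‖A e‖ - (M₁/σ³) h²`
  have hAe' : h * (g / (3 * σ ^ 2)) ≤ ‖h • A e‖ := by
    rw [norm_smul, Real.norm_of_nonneg hhpos.le]
    exact mul_le_mul_of_nonneg_left hAe hhpos.le
  have hrev : ‖h • A e‖ - ‖v xe - v xs‖ ≤ M₁ / σ ^ 3 * h * h := by
    calc ‖h • A e‖ - ‖v xe - v xs‖ ≤ ‖v xe - v xs - h • A e‖ := by
          rw [← norm_neg (v xe - v xs - h • A e)]
          have := norm_sub_norm_le (h • A e) (v xe - v xs)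
          rw [show h • A e - (v xe - v xs) = -(v xe - v xs - h • A e) by abel] at this
          exact this
      _ ≤ M₁ / σ ^ 3 * h * h := hT
  -- arithmetic: with `h = θσ`, `θ ≤ g/(6M₁)`
  have hθM : M₁ * θ ≤ g / 6 := by
    calc M₁ * θ ≤ M₁ * (g / (6 * M₁)) := mul_le_mul_of_nonneg_left hθg hM₁.le
      _ = g / 6 := by
          field_simp
          try ring
  have e1 : h * (g / (3 * σ ^ 2)) = θ * g / (3 * σ) := by
    rw [hh]
    field_simp
    try ring
  have e2 : M₁ / σ ^ 3 * h * h = M₁ * θ * θ / σ := by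
    rw [hh]
    field_simp
    try ring
  rw [e1] at hAe'
  rw [e2] at hrev
  have h3 : M₁ * θ * θ / σ ≤ g / 6 * θ / σ :=
    div_le_div_of_nonneg_right (mul_le_mul_of_nonneg_right hθM hθ.le) hσ.le
  have e3 : θ * g / (6 * σ) = θ * g / (3 * σ) - g / 6 * θ / σ := by
    field_simp
    try ring
  rw [e3]
  calc θ * g / (3 * σ) - g / 6 * θ / σ ≤ ‖h • A e‖ - M₁ * θ * θ / σ := sub_le_sub hAe' h3
    _ ≤ ‖v xe - v xs‖ := sub_le_comm.1 hrev

/-! ### Steps 4–5: a point where `v` is large carries a ball of cube mass -/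

/-- **Cube mass around a large value.**  If `‖Dv‖ ≤ M₁/σ²` on `B(y, 2Kσ)`, `‖z − y‖ < 3Kσ/2`, `‖v z‖ ≥ w/σ` and
`0 < ρ ≤ w/(2M₁)`, `ρ ≤ K/2`, then `‖v‖ ≥ w/(2σ)` on `B(z, ρσ) ⊆ B(y, 2Kσ)` and
`∫_{B(y,2Kσ)} ‖v‖³ ≥ (w/2)³ ρ³ |B(0,1)|`. -/
theorem cube_lower_bound_of_point {K M₁ σ w ρ : ℝ} (hK : 0 < K) (hM₁ : 0 < M₁) (hσ : 0 < σ) (hw : 0 < w)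
    (hρ : 0 < ρ) (hρw : ρ ≤ w / (2 * M₁)) (hρK : ρ ≤ K / 2)
    {v : EuclideanSpace ℝ (Fin 3) → EuclideanSpace ℝ (Fin 3)} {y z : EuclideanSpace ℝ (Fin 3)}
    (hdiff : ∀ x, DifferentiableAt ℝ v x)
    (hb1 : ∀ x ∈ ball y (2 * K * σ), ‖fderiv ℝ v x‖ ≤ M₁ / σ ^ 2)
    (hzd : ‖z - y‖ < 3 / 2 * K * σ) (hvz : w / σ ≤ ‖v z‖) :
    ENNReal.ofReal ((w / 2) ^ 3 * ρ ^ 3 * (volume (ball (0 : EuclideanSpace ℝ (Fin 3)) 1)).toReal) ≤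
      ∫⁻ x in ball y (2 * K * σ), ‖v x‖ₑ ^ (3 : ℝ) := by
  have hvol_top : volume (ball (0 : EuclideanSpace ℝ (Fin 3)) 1) ≠ ∞ := measure_ball_lt_top.ne
  have hV₁E : ENNReal.ofReal (volume (ball (0 : EuclideanSpace ℝ (Fin 3)) 1)).toReal =
      volume (ball (0 : EuclideanSpace ℝ (Fin 3)) 1) := ENNReal.ofReal_toReal hvol_top
  have hρσ : 0 < ρ * σ := mul_pos hρ hσ
  have hKσ : 0 < K * σ := mul_pos hK hσ
  have hsub : ball z (ρ * σ) ⊆ ball y (2 * K * σ) := by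
    intro x hx
    rw [mem_ball_iff_norm] at hx ⊢
    have h2 : ρ * σ ≤ K / 2 * σ := mul_le_mul_of_nonneg_right hρK hσ.le
    calc ‖x - y‖ ≤ ‖x - z‖ + ‖z - y‖ := norm_sub_le_norm_sub_add_norm_sub _ _ _
      _ < K / 2 * σ + 3 / 2 * K * σ := add_lt_add (hx.trans_le h2) hzd
      _ = 2 * K * σ := by linarith [hKσ]
  have hzball : z ∈ ball y (2 * K * σ) := hsub (mem_ball_self hρσ)
  have hlow : ∀ x ∈ ball z (ρ * σ), w / (2 * σ) ≤ ‖v x‖ := by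
    intro x hx
    have hmv := (convex_ball y (2 * K * σ)).norm_image_sub_le_of_norm_fderiv_le (f := v)
      (fun x' _ => hdiff x') hb1 hzball (hsub hx)
    have hdx : ‖x - z‖ < ρ * σ := by rwa [mem_ball_iff_norm] at hx
    have h1 : ‖v x - v z‖ ≤ w / (2 * σ) := by
      refine hmv.trans ?_
      calc M₁ / σ ^ 2 * ‖x - z‖ ≤ M₁ / σ ^ 2 * (ρ * σ) :=
            mul_le_mul_of_nonneg_left hdx.le (by positivity)
        _ ≤ M₁ / σ ^ 2 * (w / (2 * M₁) * σ) :=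
            mul_le_mul_of_nonneg_left (mul_le_mul_of_nonneg_right hρw hσ.le) (by positivity)
        _ = w / (2 * σ) := grad_scale_identity hM₁ hσ
    have h2 : ‖v z‖ - ‖v x‖ ≤ ‖v x - v z‖ := by
      rw [norm_sub_rev]; exact norm_sub_norm_le _ _
    have e5 : w / σ = w / (2 * σ) + w / (2 * σ) := by ring
    have h3 : ‖v z‖ - ‖v x - v z‖ ≤ ‖v x‖ := sub_le_comm.1 h2
    calc w / (2 * σ) = w / σ - w / (2 * σ) := by rw [e5, add_sub_cancel_right]
      _ ≤ ‖v z‖ - ‖v x - v z‖ := sub_le_sub hvz h1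
      _ ≤ ‖v x‖ := h3
  have hpt : ∀ x ∈ ball z (ρ * σ), ENNReal.ofReal ((w / (2 * σ)) ^ 3) ≤ ‖v x‖ₑ ^ (3 : ℝ) := by
    intro x hx
    have h0 : 0 ≤ w / (2 * σ) := by positivity
    rw [show ((w / (2 * σ)) ^ 3 : ℝ) = (w / (2 * σ)) ^ (3 : ℝ) by
          rw [show (3 : ℝ) = ((3 : ℕ) : ℝ) by norm_num, Real.rpow_natCast],
      ← ENNReal.ofReal_rpow_of_nonneg h0 (by norm_num), ← ofReal_norm]
    exact ENNReal.rpow_le_rpow (ENNReal.ofReal_le_ofReal (hlow x hx)) (by norm_num)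
  have h1 : ∫⁻ _ in ball z (ρ * σ), ENNReal.ofReal ((w / (2 * σ)) ^ 3) ≤
      ∫⁻ x in ball z (ρ * σ), ‖v x‖ₑ ^ (3 : ℝ) := setLIntegral_mono' measurableSet_ball hpt
  rw [setLIntegral_const, Measure.addHaar_ball_of_pos _ _ hρσ, finrank_euclideanSpace_fin, ← hV₁E,
    ← ENNReal.ofReal_mul (by positivity), ← ENNReal.ofReal_mul (by positivity),
    cube_scale_identity hσ] at h1
  exact h1.trans (lintegral_mono_set hsub)

/-! ### Sd -/

/-- **Sd — `EmberReadout` (the statement of `Lines/silencing_cost.lean` :598, binders verbatim): ENSTROPHY IN A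
REGULAR BOX FORCES CUBE MASS.**  For `K ≥ 1`, `M₁ ≥ 1`, `c > 0` there is `c' = c'(K,M₁,c) > 0` such that every `C²`
field `v` on `ℝ³` with `‖Dʲv(x)‖ ≤ M₁ σ^{-(j+1)}` for `j ≤ 2` on `B(y, 2Kσ)` and `∫_{B(y,Kσ)} ‖curl v‖² ≥ c/σ` has
`∫_{B(y,2Kσ)} ‖v‖³ ≥ c'`. -/
theorem emberReadout :
    ∀ K M₁ c : ℝ, 1 ≤ K → 1 ≤ M₁ → 0 < c → ∃ c' : ℝ, 0 < c' ∧
    ∀ (v : EuclideanSpace ℝ (Fin 3) → EuclideanSpace ℝ (Fin 3)) (y : EuclideanSpace ℝ (Fin 3)) (σ : ℝ),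
      0 < σ → ContDiff ℝ 2 v →
      (∀ x ∈ ball y (2 * K * σ), ∀ j : ℕ, j ≤ 2 →
        ‖iteratedFDeriv ℝ j v x‖ ≤ M₁ * σ ^ (-((j : ℝ) + 1))) →
      ENNReal.ofReal (c / σ) ≤ ∫⁻ x in ball y (K * σ), ‖curl v x‖ₑ ^ 2 →
      ENNReal.ofReal c' ≤ ∫⁻ x in ball y (2 * K * σ), ‖v x‖ₑ ^ (3 : ℝ) := by
  intro K M₁ c hK hM₁ hc
  -- the constants
  set V₁ : ℝ := (volume (ball (0 : EuclideanSpace ℝ (Fin 3)) 1)).toReal with hV₁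
  have hvol_top : volume (ball (0 : EuclideanSpace ℝ (Fin 3)) 1) ≠ ∞ := measure_ball_lt_top.ne
  have hvol_pos : 0 < volume (ball (0 : EuclideanSpace ℝ (Fin 3)) 1) := measure_ball_pos _ _ one_pos
  have hV₁pos : 0 < V₁ := ENNReal.toReal_pos hvol_pos.ne' hvol_top
  set κ : ℝ := ‖(curlCLM : (EuclideanSpace ℝ (Fin 3) →L[ℝ] EuclideanSpace ℝ (Fin 3)) →L[ℝ]
      EuclideanSpace ℝ (Fin 3))‖ + 1 with hκ
  have hκpos : 0 < κ := by rw [hκ]; positivity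
  set m : ℝ := c / (2 * V₁ * K ^ 3) with hm
  have hmpos : 0 < m := by rw [hm]; positivity
  set g : ℝ := Real.sqrt m / κ with hg
  have hgpos : 0 < g := div_pos (Real.sqrt_pos.2 hmpos) hκpos
  have hM₁pos : 0 < M₁ := by linarith
  have hKpos : 0 < K := by linarith
  set θ : ℝ := min (g / (6 * M₁)) (K / 2) with hθ
  have hθpos : 0 < θ := lt_min (by positivity) (by positivity)
  have hθg : θ ≤ g / (6 * M₁) := min_le_left _ _
  have hθK : θ ≤ K / 2 := min_le_right _ _
  set w : ℝ := θ * g / 12 with hw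
  have hwpos : 0 < w := by rw [hw]; positivity
  set ρ : ℝ := min (w / (2 * M₁)) (K / 2) with hρ
  have hρpos : 0 < ρ := lt_min (by positivity) (by positivity)
  have hρw : ρ ≤ w / (2 * M₁) := min_le_left _ _
  have hρK : ρ ≤ K / 2 := min_le_right _ _
  refine ⟨(w / 2) ^ 3 * ρ ^ 3 * V₁, by positivity, ?_⟩
  intro v y σ hσ hv hbd henst
  have hσ2 : 0 < σ ^ 2 := by positivity
  -- the box bounds in plain powers of `σ`
  have hb1 : ∀ x ∈ ball y (2 * K * σ), ‖fderiv ℝ v x‖ ≤ M₁ / σ ^ 2 := by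
    intro x hx
    have h := hbd x hx 1 (by norm_num)
    rw [norm_iteratedFDeriv_one_eq_norm_fderiv, Nat.cast_one, show (-((1 : ℝ) + 1)) = -(2 : ℝ) by norm_num,
      Real.rpow_neg hσ.le, Real.rpow_two, ← div_eq_mul_inv] at h
    exact h
  have hb2 : ∀ x ∈ ball y (2 * K * σ), ‖fderiv ℝ (fderiv ℝ v) x‖ ≤ M₁ / σ ^ 3 := by
    intro x hx
    have h := hbd x hx 2 (by norm_num)
    rw [← norm_fderiv_fderiv_eq_norm_iteratedFDeriv_two, Nat.cast_ofNat,
      show (-((2 : ℝ) + 1)) = -((3 : ℕ) : ℝ) by norm_num, Real.rpow_neg hσ.le, Real.rpow_natCast,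
      ← div_eq_mul_inv] at h
    exact h
  have hdiff : ∀ x, DifferentiableAt ℝ v x := fun x => (hv.differentiable (by norm_num)) x
  have hdiff' : ∀ x, DifferentiableAt ℝ (fderiv ℝ v) x := fun x =>
    ((hv.fderiv_right (m := 1) (by norm_num)).differentiable one_ne_zero) x
  -- (1) a point of the inner ball with large curl
  obtain ⟨xs, hxs, hxs_curl⟩ := exists_sq_le_norm_curl_of_lintegral hKpos hc hσ henst
  rw [← hV₁, ← hm] at hxs_curl
  have hxsd : ‖xs - y‖ < K * σ := by rwa [mem_ball_iff_norm] at hxs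
  -- (2) the gradient at `xs` is large, along some coordinate direction
  have hAge : g / σ ^ 2 ≤ ‖fderiv ℝ v xs‖ := by
    have h1 : Real.sqrt m / σ ^ 2 ≤ ‖curl v xs‖ := by
      have e : Real.sqrt (m / σ ^ 4) = Real.sqrt m / σ ^ 2 := by
        rw [Real.sqrt_div' _ (by positivity), show σ ^ 4 = (σ ^ 2) ^ 2 by ring, Real.sqrt_sq hσ2.le]
      rw [← e, ← Real.sqrt_sq (norm_nonneg (curl v xs))]
      exact Real.sqrt_le_sqrt hxs_curl
    have h2 : ‖curl v xs‖ ≤ κ * ‖fderiv ℝ v xs‖ := by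
      refine (norm_curl_le_norm_curlCLM_mul v xs).trans ?_
      exact mul_le_mul_of_nonneg_right (by rw [hκ]; linarith) (norm_nonneg _)
    rw [hg, div_div, show κ * σ ^ 2 = σ ^ 2 * κ by ring, ← div_div, div_le_iff₀ hκpos]
    calc Real.sqrt m / σ ^ 2 ≤ ‖curl v xs‖ := h1
      _ ≤ κ * ‖fderiv ℝ v xs‖ := h2
      _ = ‖fderiv ℝ v xs‖ * κ := mul_comm _ _
  obtain ⟨i, hi⟩ := exists_norm_apply_single_ge (fderiv ℝ v xs) hAge
  have hi' : g / (3 * σ ^ 2) ≤ ‖fderiv ℝ v xs (EuclideanSpace.single i (1 : ℝ))‖ := by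
    rw [show g / (3 * σ ^ 2) = g / σ ^ 2 / 3 by ring]
    exact hi
  have he1 : ‖EuclideanSpace.single i (1 : ℝ)‖ = 1 := by simp
  -- (3) the Taylor step
  obtain ⟨hxed, hstep⟩ :=
    taylor_step_lower_bound hKpos hM₁pos hσ hθpos hθg hθK hdiff hdiff' hb2 hxsd he1 hi'
  -- (4) a point `z` near `xs` where `‖v z‖ ≥ w/σ`
  obtain ⟨z, hzd, hvz⟩ : ∃ z : EuclideanSpace ℝ (Fin 3), ‖z - y‖ < 3 / 2 * K * σ ∧ w / σ ≤ ‖v z‖ := by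
    by_cases hcase : w / σ ≤ ‖v xs‖
    · exact ⟨xs, hxsd.trans_le (mul_le_mul_of_nonneg_right
        (le_mul_of_one_le_left hKpos.le (by norm_num)) hσ.le), hcase⟩
    · refine ⟨xs + (θ * σ) • EuclideanSpace.single i (1 : ℝ), hxed, ?_⟩
      push Not at hcase
      have e4 : 2 * (w / σ) = θ * g / (6 * σ) := by rw [hw]; ring
      have h2 : 2 * (w / σ) ≤ ‖v (xs + (θ * σ) • EuclideanSpace.single i (1 : ℝ))‖ + ‖v xs‖ := by
        rw [e4]; exact hstep.trans (norm_sub_le _ _)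
      have h3 : 2 * (w / σ) - w / σ ≤
          ‖v (xs + (θ * σ) • EuclideanSpace.single i (1 : ℝ))‖ + ‖v xs‖ - ‖v xs‖ := sub_le_sub h2 hcase.le
      have e5 : 2 * (w / σ) - w / σ = w / σ := by ring
      rwa [e5, add_sub_cancel_right] at h3
  -- (5) the cube mass around `z`
  exact cube_lower_bound_of_point hKpos hM₁pos hσ hwpos hρpos hρw hρK hdiff hb1 hzd hvz

end Summit.NavierStokesRegularity.NavierStokesRegularity.Cruxes.TypeIQuantSubcubicExp.SilencingCost

end
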